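import Literature.NumberTheory.Automorphic.LocalUnitaryGroupCongr
import Literature.NumberTheory.Automorphic.UnitaryGroupInertPlaceHyperbolicBasis
import Literature.NumberTheory.Automorphic.AnisotropicUnitaryGroupCompactOfPlace  -- ★ `conjLocal_apply_eq_of_smul_eq` (ED. 2 §3)
import Literature.NumberTheory.QuadraticForms.HermitianLocalIsotropy
import Literature.NumberTheory.QuadraticForms.LandherrHermitianMatricesDiagonalize
import Mathlib.LinearAlgebra.CrossProduct
import HarnessLib

/-!
# Hermitian frame supply at a non-split place: `ᵗ(σ_w T) · H′_w · T = a • Φ₃` for EVERY non-degenerate hermitian `H′ ∈ M₃(L)`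

[cite: Jacobowitz1962, §3] [cite: Jacobson1940HermitianForms, §3 (1)(a)] [cite: Scharlau1985HermitianForms, Ch. 10 §1]
[cite: PlatonovRapinchuk1994, §2.3]

Topic `NumberTheory/Automorphic`; namespace `Literature.NumberTheory.Automorphic.UnitaryGroup.HermitianFrame`.  THEOREMS ONLY (no `def`,
no named fact, no instance, no notation).  Organ (H2) «HERMITIAN FRAME SUPPLY AT AN INERT PLACE» of the S3-tree residue programme
(F0P3a-p06 (g15) census §5, LEAD T11-35, architect A-179): the one hypothesis of the tree's form-transport machinery that had no
supplier for a hermitian matrix of BAD reduction.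

THE MATHEMATICS.  `L` a CM field with conjugation `σ`, `v` a finite place of `L⁺` that does not split in `L` (`w ∣ v`, `σ • w = w` —
inert OR ramified, any residue characteristic), `L_w ⊃ L⁺_v` the local quadratic extension with involution `σ_w`
(`galAdicCompletionMap σ hw`), `H′ ∈ M₃(L)` hermitian and non-degenerate, `H′_w = placeForm H′ w`.  Hermitian spaces over a local
field are classified by rank and discriminant `mod N(L_w^×)` [Jacobowitz1962, §3]; in ODD rank the scalar class `a • Φ₃`
(`Φ₃ = antidiag(1,1,1)`, `a ∈ L⁺_v^×`) runs through both discriminant classes, so **`ᵗ(σ_w T) · H′_w · T = a • Φ₃` for some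
`T ∈ GL₃(L_w)`, `a = σ_w a ≠ 0`** (`exists_formCongr_placeForm_eq_smul_antidiag_three`).  The proof given here is norm-free and
elementary: (§2) diagonalise `H′` over `L` (★ `Landherr.exists_congr_diagonal`) and take an ISOTROPIC vector of the diagonal form
at `w` — rank `≥ 3` hermitian forms are isotropic at every finite place (★ Jacobson `exists_isotropic_adicCompletion_placeForm`) —
transported to `H′_w`; (§1, any field `K` with involution and `2 ≠ 0`) from an isotropic `x ≠ 0` build the HYPERBOLIC FRAME:
`y` dual to `x` (`h(x,y) = 1`, non-degeneracy), `y′ = y − (h(y,y)∕2)·x` isotropic with `h(x,y′) = 1`, `z = H′⁻¹(σx × σy′)`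
(cross product) orthogonal to `x, y′` and non-zero (`σx, σy′` are independent), `a := h(z,z) ≠ 0` (else `z ⊥` a basis), and
`T = (x | z | a·y′)` has Gram matrix `a • Φ₃` (`exists_formCongr_eq_smul_antidiag_of_isotropic`).

USE.  The similitude is exactly the input of ★ `cmDatumLocalNonsplitCongr L w hw T ha h : U(Φ₃)(L⁺_v) ≃ₜ* U(H′)(L⁺_v)`
(`nonempty_cmDatum_local_antidiag_three_equiv_of_nonsplit`), hence — the split places being free — **`U(Φ₃)(L⁺_v) ≃ₜ* U(H′)(L⁺_v)` at
EVERY finite `v`** for every non-degenerate rank-3 hermitian `H′` (`nonempty_cmDatum_local_antidiag_three_equiv`, discharging the `hns`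
hypothesis of ★ `nonempty_cmDatum_local_equiv_of_forall_nonsplit` in rank 3), and of ★ p846358's `Δ‴`-transport
(`FinExplicitTransferFactorFormTransport`) for the bad-reduction corollary of the S3-tree heads.  NO `hunr`, NO `v ∤ 2`, NO good-frame
binder `hH′w hH′i`.

**Main results.** `exists_formCongr_eq_smul_antidiag_of_isotropic` (§1, generic), `exists_formCongr_placeForm_eq_smul_antidiag_three` (§2),
`nonempty_cmDatum_local_antidiag_three_equiv_of_nonsplit`, `nonempty_cmDatum_local_antidiag_three_equiv`; ED. 2 (§3):
`exists_formCongr_conjLocal_eq_smul_antidiag_three` — the same similitude in the `L ⊗ L⁺_v` currency of ★ `cmDatumLocalCongr`.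

## References
* [Jacobowitz1962] R. Jacobowitz, *Hermitian forms over local fields*, Amer. J. Math. 84 (1962) 441–465, §3.
* [Jacobson1940HermitianForms] N. Jacobson, *A note on hermitian forms*, Bull. AMS 46 (1940) 264–268, §3 (1)(a).
* [Scharlau1985HermitianForms] W. Scharlau, *Quadratic and Hermitian Forms*, Grundlehren 270 (1985), Ch. 10 §1.
* [PlatonovRapinchuk1994] V. Platonov, A. Rapinchuk, *Algebraic Groups and Number Theory* (1994), §2.3.
-/

set_option autoImplicit false

noncomputable section

open NumberField IsDedekindDomain Matrix
open Literature.AlgebraicGeometry.ShimuraVarieties (hermForm)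

namespace Literature.NumberTheory.Automorphic.UnitaryGroup

namespace HermitianFrame

/-! ## §1 Any field with involution: the hyperbolic frame from an isotropic vector -/

section Generic

variable {K : Type*} [Field K] (σ : K →+* K)

/-- `h(u, v + v′) = h(u, v) + h(u, v′)`. [cite: Scharlau1985HermitianForms, Ch. 7 §1] -/
theorem hermForm_add_right (M : Matrix (Fin 3) (Fin 3) K) (u v v' : Fin 3 → K) :
    hermForm σ M u (v + v') = hermForm σ M u v + hermForm σ M u v' := by
  simp only [hermForm, Matrix.mulVec_add, dotProduct_add]

/-- `h(u, c • v) = c · h(u, v)`. [cite: Scharlau1985HermitianForms, Ch. 7 §1] -/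
theorem hermForm_smul_right (M : Matrix (Fin 3) (Fin 3) K) (c : K) (u v : Fin 3 → K) :
    hermForm σ M u (c • v) = c * hermForm σ M u v := by
  simp only [hermForm, Matrix.mulVec_smul, dotProduct_smul, smul_eq_mul]

/-- `h(u + u′, v) = h(u, v) + h(u′, v)`. [cite: Scharlau1985HermitianForms, Ch. 7 §1] -/
theorem hermForm_add_left (M : Matrix (Fin 3) (Fin 3) K) (u u' v : Fin 3 → K) :
    hermForm σ M (u + u') v = hermForm σ M u v + hermForm σ M u' v := by
  simp only [hermForm, dotProduct, Function.comp_apply, Pi.add_apply, map_add, add_mul, Finset.sum_add_distrib]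

/-- `h(c • u, v) = σ(c) · h(u, v)`. [cite: Scharlau1985HermitianForms, Ch. 7 §1] -/
theorem hermForm_smul_left (M : Matrix (Fin 3) (Fin 3) K) (c : K) (u v : Fin 3 → K) :
    hermForm σ M (c • u) v = σ c * hermForm σ M u v := by
  simp only [hermForm, dotProduct, Function.comp_apply, Pi.smul_apply, smul_eq_mul, map_mul, mul_assoc, Finset.mul_sum]

/-- Hermitian symmetry: `h(v, u) = σ(h(u, v))` for `σ` an involution and `ᵗ(σM) = M`. [cite: Scharlau1985HermitianForms, Ch. 7 §1] -/
theorem hermForm_swap (hσ : ∀ a, σ (σ a) = a) {M : Matrix (Fin 3) (Fin 3) K} (hM : (M.map σ)ᵀ = M) (u v : Fin 3 → K) :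
    hermForm σ M v u = σ (hermForm σ M u v) := by
  have hMij : ∀ i j, σ (M i j) = M j i := fun i j => by
    simpa only [Matrix.transpose_apply, Matrix.map_apply] using congrFun (congrFun hM j) i
  simp only [hermForm, dotProduct, Matrix.mulVec, Function.comp_apply, map_sum, map_mul, hσ, Finset.mul_sum]
  rw [Finset.sum_comm]
  refine Finset.sum_congr rfl fun i _ => Finset.sum_congr rfl fun j _ => ?_
  rw [hMij]; ring

/-- `σ(h(u, u)) = h(u, u)`. [cite: Scharlau1985HermitianForms, Ch. 7 §1] -/
theorem σ_hermForm_self (hσ : ∀ a, σ (σ a) = a) {M : Matrix (Fin 3) (Fin 3) K} (hM : (M.map σ)ᵀ = M) (u : Fin 3 → K) :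
    σ (hermForm σ M u u) = hermForm σ M u u :=
  (hermForm_swap σ hσ hM u u).symm

/-- Change of vectors: `h_M(Gu, Gv) = h_{ᵗ(σG) M G}(u, v)`. [cite: Scharlau1985HermitianForms, Ch. 7 §1] -/
theorem hermForm_mulVec_mulVec (M G : Matrix (Fin 3) (Fin 3) K) (u v : Fin 3 → K) :
    hermForm σ M (G *ᵥ u) (G *ᵥ v) = hermForm σ ((G.map σ)ᵀ * M * G) u v := by
  have h1 : (σ ∘ (G *ᵥ u)) = (G.map σ) *ᵥ (σ ∘ u) := funext fun i => RingHom.map_mulVec σ G u i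
  simp only [hermForm]
  rw [h1, ← Matrix.mulVec_mulVec, ← Matrix.mulVec_mulVec, Matrix.dotProduct_mulVec (σ ∘ u) ((G.map σ)ᵀ),
    Matrix.vecMul_transpose]

/-- The entries of `ᵗ(σT) · M · T` are the `h_M`-products of the columns of `T`. [cite: Scharlau1985HermitianForms, Ch. 7 §1] -/
theorem formCongr_apply_eq_hermForm (T : GL (Fin 3) K) (M : Matrix (Fin 3) (Fin 3) K) (i j : Fin 3) :
    formCongr σ T M i j = hermForm σ M (fun a => (T : Matrix (Fin 3) (Fin 3) K) a i) (fun a => (T : Matrix (Fin 3) (Fin 3) K) a j) := by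
  simp only [formCongr, Matrix.mul_apply, Matrix.transpose_apply, Matrix.map_apply, hermForm, dotProduct,
    Matrix.mulVec, Function.comp_apply, Finset.sum_mul, Finset.mul_sum]
  rw [Finset.sum_comm]
  exact Finset.sum_congr rfl fun a _ => Finset.sum_congr rfl fun b _ => by ring

/-- Column reading of a frame matrix built from three vectors. [cite: Scharlau1985HermitianForms, Ch. 7 §1] -/
theorem coe_mkOfDetNeZero_col (c : Fin 3 → Fin 3 → K) (h : (Matrix.of fun a i => c i a).det ≠ 0) (i : Fin 3) :
    (fun a => ((Matrix.GeneralLinearGroup.mkOfDetNeZero (Matrix.of fun a i => c i a) h : GL (Fin 3) K) :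
      Matrix (Fin 3) (Fin 3) K) a i) = c i :=
  funext fun _ => rfl

/-- Columns-to-Gram: for the frame with columns `c 0, c 1, c 2`, `ᵗ(σT) · M · T = (h_M(c i, c j))_{ij}`. [cite: Scharlau1985HermitianForms, Ch. 7 §1] -/
theorem formCongr_mkOfDetNeZero_of_cols (M : Matrix (Fin 3) (Fin 3) K) (c : Fin 3 → Fin 3 → K)
    (h : (Matrix.of fun a i => c i a).det ≠ 0) :
    formCongr σ (Matrix.GeneralLinearGroup.mkOfDetNeZero (Matrix.of fun a i => c i a) h) M =
      Matrix.of fun i j => hermForm σ M (c i) (c j) := by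
  ext i j
  rw [formCongr_apply_eq_hermForm, Matrix.of_apply, coe_mkOfDetNeZero_col, coe_mkOfDetNeZero_col]

/-- The nine Gram values of a hyperbolic frame give `a • Φ₃`. [cite: Scharlau1985HermitianForms, Ch. 7 §1] -/
theorem of_hermForm_eq_smul_antidiag (M : Matrix (Fin 3) (Fin 3) K) (c : Fin 3 → Fin 3 → K) (a : K)
    (h00 : hermForm σ M (c 0) (c 0) = 0) (h01 : hermForm σ M (c 0) (c 1) = 0) (h02 : hermForm σ M (c 0) (c 2) = a)
    (h10 : hermForm σ M (c 1) (c 0) = 0) (h11 : hermForm σ M (c 1) (c 1) = a) (h12 : hermForm σ M (c 1) (c 2) = 0)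
    (h20 : hermForm σ M (c 2) (c 0) = a) (h21 : hermForm σ M (c 2) (c 1) = 0) (h22 : hermForm σ M (c 2) (c 2) = 0) :
    (Matrix.of fun i j => hermForm σ M (c i) (c j)) =
      a • Matrix.of fun i j : Fin 3 => if i.val + j.val + 1 = 3 then (1 : K) else 0 := by
  ext i j
  fin_cases i <;> fin_cases j <;> simp [h00, h01, h02, h10, h11, h12, h20, h21, h22]

/-- `σ ∘ e_i = e_i` for a ring map `σ`. [cite: Scharlau1985HermitianForms, Ch. 7 §1] -/
theorem comp_single_one (i : Fin 3) : (σ ∘ Pi.single i (1 : K)) = Pi.single i 1 := by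
  ext j
  by_cases h : j = i
  · subst h; simp
  · simp [h]

/-- **Hyperbolic frame from an isotropic vector (rank 3, any field with involution, `2 ≠ 0`).**  `M` hermitian non-degenerate,
`x ≠ 0` with `h(x,x) = 0`: there are `T ∈ GL₃(K)` and `a = σ a ≠ 0` with `ᵗ(σT) · M · T = a • Φ₃`, `Φ₃ = antidiag(1,1,1)`.
Construction: `y` dual to `x` (`h(x,y) = 1`), `y′ = y − (h(y,y)∕2)·x` isotropic, `z = M⁻¹(σx × σy′)` orthogonal to both,
`a = h(z,z)`, `T = (x | z | a·y′)`. [cite: Jacobowitz1962, §3] [cite: Scharlau1985HermitianForms, Ch. 10 §1] -/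
theorem exists_formCongr_eq_smul_antidiag_of_isotropic (hσ : ∀ a, σ (σ a) = a) (h2 : (2 : K) ≠ 0)
    {M : Matrix (Fin 3) (Fin 3) K} (hM : (M.map σ)ᵀ = M) (hdet : M.det ≠ 0)
    {x : Fin 3 → K} (hx0 : x ≠ 0) (hx : hermForm σ M x x = 0) :
    ∃ (T : GL (Fin 3) K) (a : K), a ≠ 0 ∧ σ a = a ∧
      formCongr σ T M = a • Matrix.of fun i j : Fin 3 => if i.val + j.val + 1 = 3 then (1 : K) else 0 := by
  have h0r : ∀ u : Fin 3 → K, hermForm σ M u 0 = 0 := fun u => by simp [hermForm]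
  -- §a the dual vector `y`: `h(x, y) = 1`
  obtain ⟨k, hk⟩ := Function.ne_iff.1 hx0
  have hMu : IsUnit M.det := isUnit_iff_ne_zero.2 hdet
  have hσxk : σ (x k) ≠ 0 := (map_ne_zero σ).2 hk
  set y : Fin 3 → K := (σ (x k))⁻¹ • (M⁻¹ *ᵥ Pi.single k 1) with hy
  clear_value y
  have hxy : hermForm σ M x y = 1 := by
    rw [hy, hermForm_smul_right, hermForm, Matrix.mulVec_mulVec, Matrix.mul_nonsing_inv _ hMu, Matrix.one_mulVec,
      dotProduct_single, Function.comp_apply, mul_one, inv_mul_cancel₀ hσxk]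
  have hyx : hermForm σ M y x = 1 := by rw [hermForm_swap σ hσ hM, hxy, map_one]
  -- §b the hyperbolic partner `y′ = y + t x`, `t = -h(y,y)/2`
  set t : K := -(hermForm σ M y y) / 2 with ht
  clear_value t
  have hσt : σ t = t := by rw [ht, map_div₀, map_neg, σ_hermForm_self σ hσ hM, map_ofNat]
  set y' : Fin 3 → K := y + t • x with hy'
  clear_value y'
  have hxy' : hermForm σ M x y' = 1 := by
    rw [hy', hermForm_add_right, hxy, hermForm_smul_right, hx, mul_zero, add_zero]
  have hy'x : hermForm σ M y' x = 1 := by rw [hermForm_swap σ hσ hM, hxy', map_one]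
  have hy'y' : hermForm σ M y' y' = 0 := by
    have e : hermForm σ M y' y' = hermForm σ M y y + t + t := by
      rw [hy']
      simp only [hermForm_add_left, hermForm_add_right, hermForm_smul_left, hermForm_smul_right, hyx, hxy, hx, hσt]
      ring
    rw [e, ht]
    field_simp
    ring
  -- §c the orthogonal vector `z = M⁻¹ (σx × σy′)`
  set cv : Fin 3 → K := crossProduct (σ ∘ x) (σ ∘ y') with hcv
  clear_value cv
  set z : Fin 3 → K := M⁻¹ *ᵥ cv with hz
  clear_value z
  have hMz : M *ᵥ z = cv := by rw [hz, Matrix.mulVec_mulVec, Matrix.mul_nonsing_inv _ hMu, Matrix.one_mulVec]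
  have hxz : hermForm σ M x z = 0 := by rw [hermForm, hMz, hcv]; exact dot_self_cross _ _
  have hy'z : hermForm σ M y' z = 0 := by rw [hermForm, hMz, hcv]; exact dot_cross_self _ _
  have hzx : hermForm σ M z x = 0 := by rw [hermForm_swap σ hσ hM, hxz, map_zero]
  have hzy' : hermForm σ M z y' = 0 := by rw [hermForm_swap σ hσ hM, hy'z, map_zero]
  have hli : LinearIndependent K ![σ ∘ x, σ ∘ y'] := by
    refine LinearIndependent.pair_iff.2 fun s r hsr => ?_
    have e1 := congrArg (fun u => u ⬝ᵥ (M *ᵥ x)) hsr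
    have e2 := congrArg (fun u => u ⬝ᵥ (M *ᵥ y')) hsr
    simp only [add_dotProduct, smul_dotProduct, zero_dotProduct, smul_eq_mul] at e1 e2
    change s * hermForm σ M x x + r * hermForm σ M y' x = 0 at e1
    change s * hermForm σ M x y' + r * hermForm σ M y' y' = 0 at e2
    rw [hx, hy'x, mul_zero, zero_add, mul_one] at e1
    rw [hxy', hy'y', mul_one, mul_zero, add_zero] at e2
    exact ⟨e2, e1⟩
  have hcv0 : cv ≠ 0 := by rw [hcv]; exact crossProduct_ne_zero_iff_linearIndependent.2 hli
  have hz0 : z ≠ 0 := fun h0 => hcv0 (by rw [← hMz, h0, Matrix.mulVec_zero])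
  -- §d the frames `(x | z | e • y′)`, `e ≠ 0`, are bases
  have hAmul : ∀ (e : K) (c : Fin 3 → K),
      (Matrix.of fun a i => (![x, z, e • y'] : Fin 3 → Fin 3 → K) i a) *ᵥ c = c 0 • x + c 1 • z + (c 2 * e) • y' := by
    intro e c; ext a
    simp only [Matrix.mulVec, dotProduct, Fin.sum_univ_three, Matrix.of_apply, Matrix.cons_val_zero, Matrix.cons_val_one,
      Matrix.cons_val_two, Matrix.head_cons, Matrix.tail_cons, Pi.add_apply, Pi.smul_apply, smul_eq_mul]
    ring
  have hframe : ∀ e : K, e ≠ 0 → (Matrix.of fun a i => (![x, z, e • y'] : Fin 3 → Fin 3 → K) i a).det ≠ 0 := by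
    intro e he h0
    obtain ⟨c, hc0, hAc⟩ := Matrix.exists_mulVec_eq_zero_iff.2 h0
    rw [hAmul] at hAc
    have e1 := congrArg (fun u => hermForm σ M x u) hAc
    have e2 := congrArg (fun u => hermForm σ M y' u) hAc
    simp only [hermForm_add_right, hermForm_smul_right, hx, hxz, hxy', hy'x, hy'z, hy'y', h0r, mul_zero, mul_one,
      zero_add, add_zero] at e1 e2
    have hc2 : c 2 = 0 := (mul_eq_zero.1 e1).resolve_right he
    rw [hc2, e2, zero_mul, zero_smul, zero_smul, zero_add, add_zero] at hAc
    rcases smul_eq_zero.1 hAc with h1 | h1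
    · exact hc0 (by ext i; fin_cases i <;> simp [hc2, e2, h1])
    · exact hz0 h1
  -- `d = h(z,z) ≠ 0`: else `z` is orthogonal to the basis `(x | z | y′)`, so `M z = 0`
  set d : K := hermForm σ M z z with hd
  clear_value d
  have hσd : σ d = d := by rw [hd]; exact σ_hermForm_self σ hσ hM z
  have hd0 : d ≠ 0 := by
    intro hd0
    have hA1 := hframe 1 one_ne_zero
    have horth : ∀ u, hermForm σ M u z = 0 := by
      intro u
      have hu : u = ((Matrix.of fun a i => (![x, z, (1 : K) • y'] : Fin 3 → Fin 3 → K) i a)⁻¹ *ᵥ u) 0 • x +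
          ((Matrix.of fun a i => (![x, z, (1 : K) • y'] : Fin 3 → Fin 3 → K) i a)⁻¹ *ᵥ u) 1 • z +
          (((Matrix.of fun a i => (![x, z, (1 : K) • y'] : Fin 3 → Fin 3 → K) i a)⁻¹ *ᵥ u) 2 * 1) • y' := by
        rw [← hAmul, Matrix.mulVec_mulVec, Matrix.mul_nonsing_inv _ (isUnit_iff_ne_zero.2 hA1), Matrix.one_mulVec]
      rw [hu]
      simp only [hermForm_add_left, hermForm_smul_left, hxz, hy'z, ← hd, hd0, mul_zero, add_zero]
    have hMz0 : M *ᵥ z = 0 := by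
      ext i
      have h := horth (Pi.single i 1)
      rw [hermForm, comp_single_one, single_dotProduct, one_mul] at h
      exact h
    exact hz0 (Matrix.eq_zero_of_mulVec_eq_zero hdet hMz0)
  -- §e the frame `T = (x | z | d • y′)` and its Gram matrix `d • Φ₃`
  refine ⟨Matrix.GeneralLinearGroup.mkOfDetNeZero _ (hframe d hd0), d, hd0, hσd, ?_⟩
  rw [formCongr_mkOfDetNeZero_of_cols σ M _ (hframe d hd0)]
  refine of_hermForm_eq_smul_antidiag σ M _ d ?_ ?_ ?_ ?_ ?_ ?_ ?_ ?_ ?_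
  · exact hx
  · exact hxz
  · show hermForm σ M x (d • y') = d
    rw [hermForm_smul_right, hxy', mul_one]
  · exact hzx
  · exact hd.symm
  · show hermForm σ M z (d • y') = 0
    rw [hermForm_smul_right, hzy', mul_zero]
  · show hermForm σ M (d • y') x = d
    rw [hermForm_smul_left, hy'x, hσd, mul_one]
  · show hermForm σ M (d • y') z = 0
    rw [hermForm_smul_left, hy'z, mul_zero]
  · show hermForm σ M (d • y') (d • y') = 0
    rw [hermForm_smul_left, hermForm_smul_right, hy'y', mul_zero, mul_zero]

end Generic

/-! ## §2 The CM place: `σ_w`, `H′_w`, an isotropic vector, and the frame -/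

section CM

variable (L : Type) [Field L] [NumberField L] [IsCMField L]

omit [IsCMField L] in
/-- `placeForm Φ₃ w = Φ₃` read in `L_w` (the `0∕1` pattern is preserved by `algebraMap`). [cite: PlatonovRapinchuk1994, §5.1] -/
theorem placeForm_antidiag_three (w : HeightOneSpectrum (𝓞 L)) :
    placeForm (Matrix.of fun i j : Fin 3 => if i.val + j.val + 1 = 3 then (1 : L) else 0) w =
      Matrix.of fun i j : Fin 3 => if i.val + j.val + 1 = 3 then (1 : w.adicCompletion L) else 0 := by
  ext i j
  simp only [placeForm, Matrix.map_apply, Matrix.of_apply]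
  split_ifs <;> simp

omit [IsCMField L] in
/-- `placeForm` is multiplicative. [cite: PlatonovRapinchuk1994, §5.1] -/
theorem placeForm_mul_mul {N : ℕ} (A B C : Matrix (Fin N) (Fin N) L) (w : HeightOneSpectrum (𝓞 L)) :
    placeForm (A * B * C) w = placeForm A w * placeForm B w * placeForm C w := by
  simp only [placeForm, Matrix.map_mul]

/-- `placeForm (ᵗ(σG)) w = ᵗ(σ_w (placeForm G w))` at a place `w` fixed by `σ`. [cite: PlatonovRapinchuk1994, §5.1] -/
theorem placeForm_conjTranspose {N : ℕ} (G : Matrix (Fin N) (Fin N) L) {w : HeightOneSpectrum (𝓞 L)}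
    (hw : IsCMField.complexConj L • w = w) :
    placeForm (QuadraticForms.Landherr.conjTranspose L G) w =
      ((placeForm G w).map (galAdicCompletionMap (L := L) (IsCMField.complexConj L) hw))ᵀ := by
  have hcoe : ∀ x : L, ((x : L) : w.adicCompletion L) = algebraMap L (w.adicCompletion L) x := fun x => by
    rw [IsDedekindDomain.HeightOneSpectrum.algebraMap_adicCompletion]
    rfl
  refine Matrix.ext fun i j => ?_
  simp only [placeForm, QuadraticForms.Landherr.conjTranspose, Matrix.map_apply, Matrix.transpose_apply]
  rw [← hcoe, ← hcoe]
  exact (galAdicCompletionMap_coe_algEquiv (↥(maximalRealSubfield L)) (IsCMField.complexConj L) hw (G j i)).symm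

/-- **(H2) HERMITIAN FRAME SUPPLY AT A NON-SPLIT PLACE.**  `L` CM, `v` a finite place of `L⁺` NON-SPLIT in `L` (`w ∣ v`, `σ • w = w`;
inert or ramified, any residue characteristic), `H′ ∈ M₃(L)` hermitian (`ᵗ(σH′) = H′`) and non-degenerate.  Then there are
`T ∈ GL₃(L_w)` and `a ∈ L_w` with `a ≠ 0`, `σ_w a = a` and
`ᵗ(σ_w T) · H′_w · T = a • Φ₃`, `Φ₃ = antidiag(1,1,1)` —
exactly the similitude ★ `cmDatumLocalNonsplitCongr L w hw T ha h : U(Φ₃)(L⁺_v) ≃ₜ* U(H′)(L⁺_v)` and the reductions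
★ `nonempty_cmDatum_local_equiv_antidiag_of_forall_nonsplit_formCongr` consume (rank-3 hermitian spaces over a local field are
`rank ⊕ disc mod N(L_w^×)`, and in odd rank the scalar `a` absorbs the discriminant class).  Proof: diagonalise `H′` over `L`
(★ `Landherr.exists_congr_diagonal`), take an isotropic vector of the diagonal form at `w` (rank `3`, ★ Jacobson
`exists_isotropic_adicCompletion_placeForm`), transport it to `H′_w`, and build the hyperbolic frame of §1.
[cite: Jacobowitz1962, §3] [cite: Jacobson1940HermitianForms, §3 (1)(a)] [cite: Scharlau1985HermitianForms, Ch. 10 §1] -/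
theorem exists_formCongr_placeForm_eq_smul_antidiag_three (H' : Matrix (Fin 3) (Fin 3) L)
    (hH' : (H'.map (cmConjRingHom L))ᵀ = H') (hdet : H'.det ≠ 0)
    {v : HeightOneSpectrum (𝓞 ↥(maximalRealSubfield L))} (w : PlacesOver L v) (hw : IsCMField.complexConj L • w.1 = w.1) :
    ∃ (T : GL (Fin 3) (w.1.adicCompletion L)) (a : w.1.adicCompletion L), IsUnit a ∧
      galAdicCompletionMap (L := L) (IsCMField.complexConj L) hw a = a ∧
      formCongr (galAdicCompletionMap (L := L) (IsCMField.complexConj L) hw) T (placeForm H' w.1) =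
        a • placeForm (Matrix.of fun i j : Fin 3 => if i.val + j.val + 1 = 3 then (1 : L) else 0) w.1 := by
  -- §0 the place: `σ_w` an involution, `H′_w` hermitian non-degenerate, `2 ≠ 0`
  have hσ : ∀ a, galAdicCompletionMap (L := L) (IsCMField.complexConj L) hw (galAdicCompletionMap (L := L) (IsCMField.complexConj L) hw a) = a :=
    galAdicCompletionMap_galAdicCompletionMap_of_smul_eq (IsCMField.complexConj L) w (IsCMField.complexConj_ne_one L) hw
  have hH'c : (H'.map (IsCMField.complexConj L))ᵀ = H' := by rwa [map_cmConjRingHom_eq_map_complexConj] at hH'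
  have hM := placeForm_hermitian_of_smul_eq (IsCMField.complexConj L) w H' hH'c hw
  have hdetw : (placeForm H' w.1).det ≠ 0 := by
    have e : (placeForm H' w.1).det = algebraMap L (w.1.adicCompletion L) H'.det :=
      (RingHom.map_det (algebraMap L (w.1.adicCompletion L)) H').symm
    rw [e]; exact (map_ne_zero _).2 hdet
  have h2 : (2 : w.1.adicCompletion L) ≠ 0 := by
    have h := (map_ne_zero (algebraMap L (w.1.adicCompletion L))).2 (two_ne_zero (α := L))
    rwa [map_ofNat] at h
  -- §1 an isotropic vector of `H′_w`: diagonalise over `L`, Jacobson at `w`, transport by `G_w`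
  have hH'L : QuadraticForms.Landherr.conjTranspose L H' = H' := by
    rw [QuadraticForms.Landherr.conjTranspose, Matrix.transpose_map]; exact hH'c
  obtain ⟨G, hG, d, hd, -, hGd⟩ := QuadraticForms.Landherr.exists_congr_diagonal L H' hH'L hdet
  obtain ⟨x₀, hx₀0, hx₀⟩ := QuadraticForms.HermitianLocal.exists_isotropic_adicCompletion_placeForm L (IsCMField.complexConj L)
    (IsCMField.complexConj_ne_one L) hw (m := 3) le_rfl hd
  have hGw : (placeForm G w.1).det ≠ 0 := by
    have e : (placeForm G w.1).det = algebraMap L (w.1.adicCompletion L) G.det :=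
      (RingHom.map_det (algebraMap L (w.1.adicCompletion L)) G).symm
    rw [e]; exact (map_ne_zero _).2 hG.ne_zero
  have hx0 : placeForm G w.1 *ᵥ x₀ ≠ 0 := fun h0 => hx₀0 (Matrix.eq_zero_of_mulVec_eq_zero hGw h0)
  have hx : hermForm (galAdicCompletionMap (L := L) (IsCMField.complexConj L) hw) (placeForm H' w.1)
      (placeForm G w.1 *ᵥ x₀) (placeForm G w.1 *ᵥ x₀) = 0 := by
    rw [hermForm_mulVec_mulVec, ← placeForm_conjTranspose L G hw, ← placeForm_mul_mul, hGd]
    exact hx₀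
  -- §2 the frame
  obtain ⟨T, a, ha0, hσa, hT⟩ := exists_formCongr_eq_smul_antidiag_of_isotropic
    (galAdicCompletionMap (L := L) (IsCMField.complexConj L) hw) hσ h2 hM hdetw hx0 hx
  exact ⟨T, a, isUnit_iff_ne_zero.2 ha0, hσa, by rw [hT, placeForm_antidiag_three]⟩

/-- **`U(Φ₃)(L⁺_v) ≃ₜ* U(H′)(L⁺_v)` at a NON-SPLIT place** for every non-degenerate rank-3 hermitian `H′` (the similitude of
`exists_formCongr_placeForm_eq_smul_antidiag_three` fed to ★ `cmDatumLocalNonsplitCongr`). [cite: PlatonovRapinchuk1994, §2.3]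
[cite: Jacobowitz1962, §3] -/
theorem nonempty_cmDatum_local_antidiag_three_equiv_of_nonsplit (H' : Matrix (Fin 3) (Fin 3) L)
    (hH' : (H'.map (cmConjRingHom L))ᵀ = H') (hdet : H'.det ≠ 0)
    {v : HeightOneSpectrum (𝓞 ↥(maximalRealSubfield L))} (w : PlacesOver L v) (hw : IsCMField.complexConj L • w.1 = w.1) :
    Nonempty ((cmDatum L 3 (Matrix.of fun i j : Fin 3 => if i.val + j.val + 1 = 3 then (1 : L) else 0)).Local v ≃ₜ*
      (cmDatum L 3 H').Local v) := by
  obtain ⟨T, a, ha, -, h⟩ := exists_formCongr_placeForm_eq_smul_antidiag_three L H' hH' hdet w hw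
  exact ⟨cmDatumLocalNonsplitCongr L w hw T ha h⟩

/-- **`U(Φ₃)(L⁺_v) ≃ₜ* U(H′)(L⁺_v)` at EVERY finite place `v`** for every non-degenerate rank-3 hermitian `H′ ∈ M₃(L)` over a CM field:
the split places are free (★ `nonempty_cmDatum_local_equiv_of_forall_nonsplit`), the non-split ones are the previous theorem — the
`hns` hypothesis of the tree's reduction discharged in rank `3`. [cite: Rogawski1990, §14.2 p. 232] [cite: Jacobowitz1962, §3] -/
theorem nonempty_cmDatum_local_antidiag_three_equiv (H' : Matrix (Fin 3) (Fin 3) L)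
    (hH' : (H'.map (cmConjRingHom L))ᵀ = H') (hdet : H'.det ≠ 0) (v : HeightOneSpectrum (𝓞 ↥(maximalRealSubfield L))) :
    Nonempty ((cmDatum L 3 (Matrix.of fun i j : Fin 3 => if i.val + j.val + 1 = 3 then (1 : L) else 0)).Local v ≃ₜ*
      (cmDatum L 3 H').Local v) :=
  nonempty_cmDatum_local_equiv_of_forall_nonsplit L (antidiagOne_isHermitian L 3) (isUnit_antidiagOne_det L 3) hH'
    (isUnit_iff_ne_zero.2 hdet) (fun _ w hw => nonempty_cmDatum_local_antidiag_three_equiv_of_nonsplit L H' hH' hdet w hw) v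

/-! ## §3 The same similitude in the `E_v = L ⊗ L⁺_v = ∏_{w′ ∣ v} L_{w′}` currency of ★ `cmDatumLocalCongr` -/

/-- **(H2) in the `L ⊗ L⁺_v` currency** (the hypothesis shape `(T, a, ha, haσ, h)` of ★ `cmDatumLocalCongr` ∕ ★
`localTransferAtOne_transport_of_formCongr` ∕ ★ `localTransferAtOne_of_hyperspecialLevel_le_one_of_formCongr`): at a non-split `v`
there are `T ∈ GL₃(L ⊗ L⁺_v)` and a `(σ ⊗ 1)`-fixed unit `a` with `ᵗ((σ ⊗ 1) T) · (H′ ⊗ 1) · T = a • (Φ₃ ⊗ 1)` — the one-place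
similitude of `exists_formCongr_placeForm_eq_smul_antidiag_three` transported along `L ⊗ L⁺_v = L_w` (`w` the only place above `v`,
`RingEquiv.piUnique`). [cite: Jacobowitz1962, §3] [cite: PlatonovRapinchuk1994, §2.3] [cite: CasselsFrohlichANT1967, Ch. II §10] -/
theorem exists_formCongr_conjLocal_eq_smul_antidiag_three (H' : Matrix (Fin 3) (Fin 3) L)
    (hH' : (H'.map (cmConjRingHom L))ᵀ = H') (hdet : H'.det ≠ 0)
    {v : HeightOneSpectrum (𝓞 ↥(maximalRealSubfield L))} (w : PlacesOver L v) (hw : IsCMField.complexConj L • w.1 = w.1) :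
    ∃ (T : GL (Fin 3) (LocalRing L v)) (a : LocalRing L v), IsUnit a ∧
      conjLocal L (IsCMField.complexConj L) v a = a ∧
      formCongr (conjLocal L (IsCMField.complexConj L) v) T (H'.map (algebraMap L (LocalRing L v))) =
        a • (Matrix.of fun i j : Fin 3 => if i.val + j.val + 1 = 3 then (1 : L) else 0).map (algebraMap L (LocalRing L v)) := by
  obtain ⟨Tw, aw, haw, hσa, hT⟩ := exists_formCongr_placeForm_eq_smul_antidiag_three L H' hH' hdet w hw
  haveI : Subsingleton (PlacesOver L v) :=
    PlacesOver.subsingleton_of_smul_eq (IsCMField.complexConj L) (IsCMField.complexConj_ne_one L) w hw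
  letI : Unique (PlacesOver L v) := uniqueOfSubsingleton w
  let π : LocalRing L v ≃+* w.1.adicCompletion L := RingEquiv.piUnique fun w' : PlacesOver L v => w'.1.adicCompletion L
  have hπ : ∀ x : LocalRing L v, π x = x w := fun _ => rfl
  have hπs : ∀ y : w.1.adicCompletion L, (π.symm y) w = y := fun y => by
    have h := π.apply_symm_apply y
    rwa [hπ] at h
  have hconj : ∀ x : LocalRing L v, conjLocal L (IsCMField.complexConj L) v x w =
      galAdicCompletionMap (L := L) (IsCMField.complexConj L) hw (x w) := fun x =>
    conjLocal_apply_eq_of_smul_eq (IsCMField.complexConj L) (IsCMField.complexConj_ne_one L) v w hw x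
  let e : Matrix (Fin 3) (Fin 3) (w.1.adicCompletion L) ≃* Matrix (Fin 3) (Fin 3) (LocalRing L v) := π.symm.mapMatrix.toMulEquiv
  have hTe : ((Units.mapEquiv e Tw).val : Matrix (Fin 3) (Fin 3) (LocalRing L v)) =
      (Tw : Matrix (Fin 3) (Fin 3) (w.1.adicCompletion L)).map π.symm := rfl
  refine ⟨Units.mapEquiv e Tw, π.symm aw, haw.map π.symm, ?_, ?_⟩
  · rw [LocalRing.eq_iff_apply_eq (IsCMField.complexConj L) (IsCMField.complexConj_ne_one L) w hw, hconj, hπs, hσa]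
  · refine Matrix.ext fun i j =>
      (LocalRing.eq_iff_apply_eq (IsCMField.complexConj L) (IsCMField.complexConj_ne_one L) w hw _ _).2 ?_
    have hTij := congrFun (congrFun hT i) j
    simp only [formCongr, Matrix.mul_apply, Matrix.transpose_apply, Matrix.map_apply, Matrix.smul_apply, smul_eq_mul,
      placeForm] at hTij
    simp only [formCongr, Matrix.mul_apply, Matrix.transpose_apply, Matrix.map_apply, Matrix.smul_apply, smul_eq_mul,
      Finset.sum_apply, Pi.mul_apply, hTe, hconj, hπs, Pi.algebraMap_apply]
    exact hTij

end CM

end HermitianFrame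

end Literature.NumberTheory.Automorphic.UnitaryGroup

end
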